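import Summits.AtomisticToContinuum.Crystallization.Theses.PalmUnimodularRigidity
import Summits.AtomisticToContinuum.Crystallization.Theorems.ShellsToBarlowChart.Negative.ScaleWindow

/-!
# Skeleton line `develop-the-model-growth-descent` — crux `ShellsToBarlowChart`
# (stmt-AtomisticToContinuum-9227, route `PalmUnimodularRigidity`, sub-problem `Crystallization`)

Idea (card `Ideas/develop-the-model-growth-descent.md`, triage r1-1/2/3: pass): develop the
MODEL into `S` — a bond-graph covering `Ψ : barlowStacking 1 √(2/3) s → S` built by Hales's layer
induction run on the simply connected ideal stacking (layers are honest lattices `ℤ²`) — and then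
kill the deck group by COUNTING: a non-trivial deck transformation has a power that is a non-zero
translation `τ` of the stacking, so the window-graph balls of `S = Ψ(B)` grow at most
quadratically, whereas the hard core `0.891`, the covering radius `≤ 0.7215` and greedy
quasi-geodesics force cubic growth.  Hence `Ψ` is injective, i.e. the bond isomorphism of the crux.

Seven registered stubs (`stub_*`, the only declarations containing `sorry`; the planner's `stub_modelCovering` = `stub_developCovering ∘ stub_transportSystem`, reshaped by the lead in cycle 1), the kernel-checked
composition `barlowChart_of_stubs : stub₁ → ⋯ → stub₆ → ∀ S, S.Nonempty → GoodShells S → BarlowChart S`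
(hypotheses = the six stub statements verbatim; proof real, no `sorry`), and the skeleton theorem
`ShellsToBarlowChart_of : ShellsToBarlowChart` (the crux BY NAME, obtained by feeding the six registered
stubs to the composition through `shellsToBarlowChart_iff_scaled : … := Iff.rfl`; its only `sorryAx`
dependence is through the stubs):

* `stub_localCharts`      (M)  — the four margins: window graph = shell graph, links exact.
* `stub_transportSystem`  (XL, HARDEST) — the geometric front end: commuting frame transports
                                 `I, J, V` with parity on the every-point-good set (lead reshape of
                                 the former `stub_modelCovering`, cycle 1).
* `stub_developCovering`  (M)  — the algebraic front end: a transport system gives a Hägg word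
                                 and a star-bijective, link-faithful, surjective bond covering.
* `stub_deckTransitive`   (L)  — the universal-cover step (triage r1-2/r1-3 sharpening): the
                                 flag complex of the stacking is simply connected, so a
                                 coincidence `Ψ p = Ψ p'`, `p ≠ p'`, is realised by a FIXED-POINT-
                                 FREE contact-graph automorphism `σ` of the stacking over `Ψ`.
* `stub_powerTranslation` (M)  — torsion + Bieberbach on the model: a contact automorphism moving
                                 every site by graph distance `≥ 3` has a power equal to a
                                 non-zero translation preserving the stacking.
* `stub_quotientGrowth`   (M)  — `τ`-invariant star-surjective `Ψ` ⇒ quadratic growth of the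
                                 window-graph balls of `S` around `Ψ p`.
* `stub_cubicGrowth`      (M)  — every-point-good `S` has `(n/6)³ ≤ #Ball_n(x)` for `n ≥ 12`.

Disproof used (landed negatives, namespace `…Theorems.ShellsToBarlowChartNegative`; `Negative/ScaleWindow`
is imported and its four lemmas are restated by `example` in § Disproof ledger below; `Negative/Tolerance`
(`shellsToBarlowChart_false_tol_eighth`, `equatorPropagation_margin`, `capClash_lt_hardCore`,
`hardCore_bounds`) is cited by name only — the farm had not yet built that module at check time,
the lead should add the import once it is built):
`shellsToBarlowChart_false_without_nonempty` — `S.Nonempty` is consumed by `stub_modelCovering`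
(`MapsTo Ψ B S` is impossible for `S = ∅`); `…_false_without_scaleUpper/Lower`,
`…_false_tol_eighth` — the window `[9/10,1]` and the tolerance `1/100` enter through the bond-window
identification of `stub_localCharts` (margins `1.01a ≤ 28/25 < 1.25a`, `1.02a ≤ 28/25 < (√2−0.02)a`);
`…_false_subshell` — exclusivity `↑T = shell` is consumed by `stub_localCharts` (bonded ⇒ shell),
`stub_cubicGrowth` (hard core / covering radius) and the occupancy lemma inside `stub_modelCovering`;
`not_shellsToFccChart` — the Hägg word stays existential (read from parities on the model).
No stub is an instance of a landed Negative lemma: every stub keeps `S.Nonempty`, the window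
`[9/10, 1]` (via `GoodShells`), the full-shell identity and tolerance `1/100` exactly as the crux.
-/

noncomputable section

namespace Summit.AtomisticToContinuum.Crystallization.Cruxes.ShellsToBarlowChart.DevelopTheModelGrowthDescent

open Literature.Geometry.DiscreteGeometry Literature.MathematicalPhysics.StatisticalMechanics
open Summit.AtomisticToContinuum.Crystallization.Theses.PalmUnimodularRigidity
open Summit.AtomisticToContinuum.Crystallization.Theorems.ShellsToBarlowChartNegative

/-- Euclidean `3`-space. -/
local notation "E3" => EuclideanSpace ℝ (Fin 3)

/-! ## Vocabulary (thin wrappers; the crux hypothesis/conclusion are the landed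
`GoodShellAt (9/10) 1` / `BarlowChart`, definitionally the crux: `shellsToBarlowChart_iff_scaled`) -/

/-- Every point of `S` has a `1 %`-good FCC/HCP shell at its own scale in `[9/10, 1]`
(the crux hypothesis, via the landed parametrisation). -/
def GoodShells (S : Set E3) : Prop := ∀ x ∈ S, GoodShellAt (9 / 10) 1 S x

/-- The bond relation of the crux conclusion: distance in the window `(0, 28/25]`. -/
def IsBond (x y : E3) : Prop := 0 < dist x y ∧ dist x y ≤ 28 / 25

/-- The bonded neighbours of `x` inside `S`. -/
def bondNbrs (S : Set E3) (x : E3) : Set E3 := {y | y ∈ S ∧ IsBond x y}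

/-- The twelve contacts of `p` in the MODEL `B := barlowStacking 1 √(2/3) s` (ideal stacking, spacing `1`). -/
def contacts (s : ℤ → ℤ) (p : E3) : Set E3 := {q | q ∈ barlowStacking 1 (Real.sqrt (2 / 3)) s ∧ dist p q = 1}

/-- The window graph of `S`: vertices of `S`, edges = bonds. -/
def windowGraph (S : Set E3) : SimpleGraph E3 :=
  SimpleGraph.fromRel fun x y => x ∈ S ∧ y ∈ S ∧ IsBond x y

/-- The closed ball of radius `n` about `x` in the window graph of `S` (walks of length `≤ n`). -/
def windowBall (S : Set E3) (x : E3) (n : ℕ) : Set E3 :=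
  {y | ∃ w : (windowGraph S).Walk x y, w.length ≤ n}

/-- LOCAL CHART at `x`: the bonded neighbours of `x` are an `a/100`-perturbed rotated copy of the
`a`-scaled FCC or HCP pattern, and the bonds AMONG them are exactly the pattern contacts
("window graph = shell graph, links exact" — the four margins of the disprover). -/
def LocalChart (S : Set E3) (x : E3) : Prop :=
  ∃ a : ℝ, 9 / 10 ≤ a ∧ a ≤ 1 ∧ ∃ P : Finset E3, (P = fccKissingPattern ∨ P = hcpKissingPattern) ∧
    ∃ A : E3 →ₗᵢ[ℝ] E3, ∃ e : E3 → E3, Set.BijOn e (↑P : Set E3) (bondNbrs S x) ∧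
      (∀ v ∈ P, dist (e v) (x + a • A v) ≤ a / 100) ∧
      (∀ v ∈ P, ∀ w ∈ P, (dist v w = 1 ↔ IsBond (e v) (e w)))

/-- BOND COVERING: `Ψ` maps the model onto `S`, the contacts of every site bijectively onto the
bonded neighbours of its image, and is faithful on links (contacts among contacts ↔ bonds among
their images) — a covering map of the flag `2`-complexes.  Strictly weaker than the crux: it holds
verbatim for every quotient `B/Γ` (`B = barlowStacking 1 √(2/3) s`). -/
def IsBondCovering (S : Set E3) (s : ℤ → ℤ) (Ψ : E3 → E3) : Prop :=
  Set.MapsTo Ψ (barlowStacking 1 (Real.sqrt (2 / 3)) s) S ∧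
    Set.SurjOn Ψ (barlowStacking 1 (Real.sqrt (2 / 3)) s) S ∧
    (∀ p ∈ barlowStacking 1 (Real.sqrt (2 / 3)) s, Set.BijOn Ψ (contacts s p) (bondNbrs S (Ψ p))) ∧
    (∀ p ∈ barlowStacking 1 (Real.sqrt (2 / 3)) s, ∀ q ∈ contacts s p, ∀ q' ∈ contacts s p,
      (dist q q' = 1 ↔ IsBond (Ψ q) (Ψ q')))

/-- CONTACT AUTOMORPHISM of the model: a bijection of `B` preserving and reflecting contacts. -/
def IsContactAut (s : ℤ → ℤ) (σ : E3 → E3) : Prop :=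
  Set.BijOn σ (barlowStacking 1 (Real.sqrt (2 / 3)) s) (barlowStacking 1 (Real.sqrt (2 / 3)) s) ∧
    ∀ q ∈ barlowStacking 1 (Real.sqrt (2 / 3)) s, ∀ q' ∈ barlowStacking 1 (Real.sqrt (2 / 3)) s, (dist (σ q) (σ q') = 1 ↔ dist q q' = 1)

/-- **Transport system on `S`** (the lead's reshape of `stub_modelCovering`, cycle 1): an
abstract type of frames `F` with a point map `pt : F → S`, three pairwise COMMUTING permutations
`I, J, V` of `F` (transport along the two in-layer generators and to the next layer), a parity
`par : F → {1, −1}` invariant under `I` and `J` (the Hägg letter of the layer of the frame), and a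
base frame `f₀`, such that (i) every point of `S` is reached from `f₀`, (ii) STAR: at every frame
`f` the twelve frames `V^r (J^(−Q) (I^(−P) f))`, `(r,P,Q) ∈ linkOffsets (par (V⁻¹ f)) (par f)`
(relative coordinates of the twelve contacts of a site of a Barlow stacking with letters
`par (V⁻¹ f)` below and `par f` above, `BarlowRings.lean`), are mapped by `pt` bijectively onto
the bonded neighbours of `pt f`, and (iii) LINK: two of them are bonded iff the relative
coordinates are `linkAdj`.  Identical text to the (review-queued) Theorems module
`PalmUnimodularRigidityShellsToBarlowChartTransportDefs`. -/
def TransportSystem (S : Set E3) : Prop :=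
  ∃ (F : Type) (pt : F → E3) (I J V : Equiv.Perm F) (par : F → ℤ) (f₀ : F),
    (∀ f, I (J f) = J (I f)) ∧ (∀ f, I (V f) = V (I f)) ∧ (∀ f, J (V f) = V (J f)) ∧
    (∀ f, pt f ∈ S) ∧
    (∀ f, par f = 1 ∨ par f = -1) ∧ (∀ f, par (I f) = par f) ∧ (∀ f, par (J f) = par f) ∧
    (∀ y ∈ S, ∃ a b c : ℤ, pt ((V ^ c) ((J ^ b) ((I ^ a) f₀))) = y) ∧
    (∀ f, Set.BijOn (fun x : ℤ × ℤ × ℤ => pt ((V ^ x.1) ((J ^ (-x.2.2)) ((I ^ (-x.2.1)) f))))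
        (↑(linkOffsets (par (V⁻¹ f)) (par f)) : Set (ℤ × ℤ × ℤ))
        {y | y ∈ S ∧ (0 < dist (pt f) y ∧ dist (pt f) y ≤ 28 / 25)}) ∧
    (∀ f, ∀ x ∈ linkOffsets (par (V⁻¹ f)) (par f), ∀ y ∈ linkOffsets (par (V⁻¹ f)) (par f),
        ((0 < dist (pt ((V ^ x.1) ((J ^ (-x.2.2)) ((I ^ (-x.2.1)) f))))
                (pt ((V ^ y.1) ((J ^ (-y.2.2)) ((I ^ (-y.2.1)) f)))) ∧
          dist (pt ((V ^ x.1) ((J ^ (-x.2.2)) ((I ^ (-x.2.1)) f))))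
                (pt ((V ^ y.1) ((J ^ (-y.2.2)) ((I ^ (-y.2.1)) f)))) ≤ 28 / 25) ↔
          linkAdj (par (V⁻¹ f)) (par f) x y))

/-! ## Disproof ledger: the landed negatives this line answers to (imports are live) -/

/-- H = `S.Nonempty` is load-bearing — consumed by `stub_modelCovering` (`MapsTo Ψ B ∅` is absurd). -/
example : ¬ ∀ S : Set E3, (∀ x ∈ S, GoodShellAt (9 / 10) 1 S x) → BarlowChart S :=
  shellsToBarlowChart_false_without_nonempty

/-- H = upper scale bound `a ≤ 1` — consumed by `stub_localCharts` (`1.01·a ≤ 28/25`). -/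
example : ¬ ShellsToBarlowChartScaled (9 / 10) 2 := shellsToBarlowChart_false_without_scaleUpper

/-- H = lower scale bound `9/10 ≤ a` — consumed by `stub_localCharts` (`28/25 < (√2 − 0.02)·a`). -/
example : ¬ ShellsToBarlowChartScaled (1 / 2) 1 := shellsToBarlowChart_false_without_scaleLower

/-- H = exclusivity `↑T = shell` — consumed by `stub_localCharts` (bonded ⇒ shell point),
`stub_cubicGrowth` (hard core, covering radius) and the occupancy lemma of `stub_modelCovering`. -/
example := shellsToBarlowChart_false_subshell

/-- Calibration (non-vacuity): the model itself satisfies the hypothesis, so `stub_modelCovering`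
with `Ψ = id` is the exact case and no stub can exclude ideal stackings. -/
example {s : ℤ → ℤ} (hs : IsHaggSeq s) :
    ∀ x ∈ barlowStacking 1 (1 * Real.sqrt (2 / 3)) s,
      GoodShellAt (9 / 10) 1 (barlowStacking 1 (1 * Real.sqrt (2 / 3)) s) x :=
  (hypothesis_barlowStacking hs (by norm_num) le_rfl).2

/-! ## The six stubs -/

/-- **stub 1 — local charts (size M).**  Under the crux hypothesis the bonded neighbours of every
`x ∈ S` are exactly its twelve shell points, `a/100`-matched to a rotated `a`-scaled pattern, and
two of them are bonded iff the corresponding pattern points touch.  Margins (disprover, `margins`):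
`1.01a ≤ 28/25 < 1.25a`, `1.02a ≤ 28/25 < (√2 − 0.02)a` for `a ∈ [9/10, 1]`; pattern pair
distances are `1` or `≥ √2` (`fccInt_pair_sqNorm`, `hcpInt_pair_sqNorm`). -/
theorem stub_localCharts :
    ∀ S : Set E3, GoodShells S → ∀ x ∈ S, LocalChart S x := by
  sorry

/-- **stub 2a — the transport system of an every-point-good set (size XL; the HARDEST stub;
the lead's geometric half of the former `stub_modelCovering`).**  For a non-empty every-point-good
`S` with local charts there is a `TransportSystem S`.  Plan (lead, NOTES.md § modelCovering
design): frames `(x; t₁, t₂, U)` = a site, an ordered adjacent pair of INTEGER labels spanning a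
pattern hexagon, and a cap `U` (the upper side); transports `I, J` (hexagon continuation through
the shared neighbours), `V` (the cap site over the parity-appropriate triangle), parity read in
the chart; the ONLY metric input is the transfer lemma "squared label distances `≤ 54` (units
`18` = bond²) of two common neighbours agree in the charts of two bonded sites" (margin `a/40`,
`equatorPropagation_margin`), everything else is a decidable enumeration on `fccInt`/`hcpInt`
(P1 = equator propagation, parity invariance, the commutations `IJ = JI`, `IV = VI`, `JV = VJ`);
Hales's dichotomy (all sites FCC: any base frame; else start on an HCP equator and build the
layers by `V`), frames indexed by `ℤ³` with the coordinate shifts as `I, J, V`. -/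
theorem stub_transportSystem :
    ∀ S : Set E3, S.Nonempty → GoodShells S → (∀ x ∈ S, LocalChart S x) → TransportSystem S := by
  sorry

/-- **stub 2b — develop the covering from a transport system (size M; the algebraic half of the
former `stub_modelCovering`).**  `s k := par (V^k f₀)` is a Hägg word and
`Ψ (barlowPos 1 √(2/3) s k i j) := pt (V^k (J^j (I^i f₀)))` is a bond covering: well-defined by
injectivity of `barlowPos` (`le_dist_barlowPos`), star-bijective and link-faithful by
`touching_iff_exists_linkOffsets` / `dist_relPos_eq_iff_linkAdj` (the twelve contacts of
`barlowPos k i j` are `relPos k i j x = barlowPos (k + x.1) (i − x.2.1) (j − x.2.2)`,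
`x ∈ linkOffsets (s (k−1)) (s k)`, and `Ψ` of them is `pt (V^(x.1) (J^(−x.2.2) (I^(−x.2.1) f)))`
by the commutations and `zpow_add`), onto by clause (i). -/
theorem stub_developCovering :
    ∀ S : Set E3, TransportSystem S → ∃ s : ℤ → ℤ, IsHaggSeq s ∧ ∃ Ψ : E3 → E3, IsBondCovering S s Ψ := by
  sorry

/-- **stub 3 — the deck group acts freely and transitively on fibres (size L).**  The flag
`2`-complex of the contact graph of `B` is connected and simply connected (it is the
`2`-skeleton of the tetrahedron/octahedron tiling of `ℝ³`; octahedron squares bound four contact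
triangles through an apex), and a bond covering is a covering map of flag complexes, hence the
universal one: two sites with the same image differ by a deck transformation, which is a
contact-graph automorphism over `Ψ`, and a deck transformation with `p ≠ p'` fixes no site. -/
theorem stub_deckTransitive :
    ∀ (S : Set E3) (s : ℤ → ℤ) (Ψ : E3 → E3), IsHaggSeq s → IsBondCovering S s Ψ →
      ∀ p ∈ barlowStacking 1 (Real.sqrt (2 / 3)) s, ∀ p' ∈ barlowStacking 1 (Real.sqrt (2 / 3)) s, Ψ p = Ψ p' → p ≠ p' →
        ∃ σ : E3 → E3, IsContactAut s σ ∧ (∀ q ∈ barlowStacking 1 (Real.sqrt (2 / 3)) s, Ψ (σ q) = Ψ q) ∧ σ p = p' ∧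
          ∀ q ∈ barlowStacking 1 (Real.sqrt (2 / 3)) s, σ q ≠ q := by
  sorry

/-- **stub 4 — a site-free contact automorphism has a translation power (size M).**  A contact
automorphism `σ` of `B` moving every site by graph distance `≥ 3` (no fixed site, no site moved
to a contact, no site moved to a contact of a contact) has a power `σ^[n]` equal on `B` to a
non-zero translation `τ` with `B ± τ ⊆ B`.  Plan: `σ` extends to a Euclidean isometry `g`
(stars are rigid: `isArrangedIn_fcc_of_contactGraph_iso` and its HCP twin; adjacent stars share
five spanning points); a finite-order `g` fixes a point of `ℝ³`, which is within `1/√2` of a site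
`b` (`exists_dist_barlowPos_lt_two`, rescaled), so `dist b (g b) < 2`, i.e. graph distance `≤ 2`
in the ideal stacking — excluded; so `g` has infinite order, its linear part permutes the `≤ 18`
bond directions, hence has finite order `n`, and `g^n` is the translation. -/
theorem stub_powerTranslation :
    ∀ (s : ℤ → ℤ) (σ : E3 → E3), IsHaggSeq s → IsContactAut s σ →
      (∀ q ∈ barlowStacking 1 (Real.sqrt (2 / 3)) s, σ q ≠ q) →
      (∀ q ∈ barlowStacking 1 (Real.sqrt (2 / 3)) s, dist q (σ q) ≠ 1) →
      (∀ q ∈ barlowStacking 1 (Real.sqrt (2 / 3)) s, ∀ m ∈ barlowStacking 1 (Real.sqrt (2 / 3)) s, dist q m = 1 → dist m (σ q) ≠ 1) →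
        ∃ τ : E3, τ ≠ 0 ∧ (∀ q ∈ barlowStacking 1 (Real.sqrt (2 / 3)) s, q + τ ∈ barlowStacking 1 (Real.sqrt (2 / 3)) s ∧ q - τ ∈ barlowStacking 1 (Real.sqrt (2 / 3)) s) ∧
          ∃ n : ℕ, ∀ q ∈ barlowStacking 1 (Real.sqrt (2 / 3)) s, σ^[n] q = q + τ := by
  sorry

/-- **stub 5 — quotients by a translation grow quadratically (size M).**  If `Ψ` is invariant
under a non-zero period `τ` of the model and every bonded neighbour of `Ψ p` is the image of a
contact of `p` (path lifting), then the window-graph ball of radius `n` about `Ψ p` is the image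
of the contact ball of radius `n` about `p`, whose `τ`-classes are represented in a cylinder of
radius `n` and height `‖τ‖`; the hard core `min 1 √(2/3)` of the model
(`le_dist_of_mem_barlowStacking`) bounds their number by `K · (n + 1)²`. -/
theorem stub_quotientGrowth :
    ∀ (S : Set E3) (s : ℤ → ℤ) (Ψ : E3 → E3) (τ : E3), IsHaggSeq s →
      (∀ p ∈ barlowStacking 1 (Real.sqrt (2 / 3)) s, bondNbrs S (Ψ p) ⊆ Ψ '' contacts s p) →
      τ ≠ 0 → (∀ q ∈ barlowStacking 1 (Real.sqrt (2 / 3)) s, q + τ ∈ barlowStacking 1 (Real.sqrt (2 / 3)) s ∧ q - τ ∈ barlowStacking 1 (Real.sqrt (2 / 3)) s) → (∀ q ∈ barlowStacking 1 (Real.sqrt (2 / 3)) s, Ψ (q + τ) = Ψ q) →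
        ∀ p ∈ barlowStacking 1 (Real.sqrt (2 / 3)) s, ∃ K : ℝ, ∀ n : ℕ,
          (Set.ncard (windowBall S (Ψ p) n) : ℝ) ≤ K * ((n : ℝ) + 1) ^ 2 := by
  sorry

/-- **stub 6 — cubic growth of an every-point-good set (size M).**  Hard core `0.891` and
covering radius `≤ 0.7215` (nearest-direction neighbour within `45.58°`; `hardCore_bounds`), plus
greedy quasi-geodesics (each step from Euclidean distance `d ≥ 2` gains `≥ 0.48`; from `d < 2`
three steps suffice since no point sits at distance in `(1.01a, 1.25a)` of another) give
graph distance `≤ 3·dist + 4`, so the graph ball of radius `n` contains `S ∩ B(x, (n − 4)/3)`,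
which has `≥ ((R − ρ)/ρ)³ ≥ (n/6)³` points for `n ≥ 12` by volume. -/
theorem stub_cubicGrowth :
    ∀ S : Set E3, GoodShells S → ∀ x ∈ S, ∀ n : ℕ, 12 ≤ n →
      ((n : ℝ) / 6) ^ 3 ≤ (Set.ncard (windowBall S x n) : ℝ) := by
  sorry

/-! ## The composition (kernel-checked, no `sorry`) -/

/-- **The six stub statements imply the crux, pointwise** (hypotheses are the stub statements
verbatim; `GoodShells S` / `BarlowChart S` are the landed parametrisation of the crux hypothesis /
conclusion, definitionally the crux: `shellsToBarlowChart_iff_scaled`).  Logic of the descent: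
develop the model (`stub 1, 2`); if `Ψ p = Ψ p'` with `p ≠ p'`, a site-free deck automorphism
exists (`stub 3`), it moves every site by graph distance `≥ 3` because `Ψ` is injective on closed
stars and on contacts of a common site, so a power of it is a non-zero period `τ` of the model
over `Ψ` (`stub 4`); then balls of `S` grow at most quadratically (`stub 5`) and at least
cubically (`stub 6`) — contradiction for `n > 216 K + 216`.  So `Ψ` is a bijection, and
bond-faithfulness is star-bijectivity plus injectivity. -/
theorem barlowChart_of_stubs
    (h₁ : ∀ S : Set E3, GoodShells S → ∀ x ∈ S, LocalChart S x)
    (h₂ : ∀ S : Set E3, S.Nonempty → GoodShells S → (∀ x ∈ S, LocalChart S x) →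
      ∃ s : ℤ → ℤ, IsHaggSeq s ∧ ∃ Ψ : E3 → E3, IsBondCovering S s Ψ)
    (h₃ : ∀ (S : Set E3) (s : ℤ → ℤ) (Ψ : E3 → E3), IsHaggSeq s → IsBondCovering S s Ψ →
      ∀ p ∈ barlowStacking 1 (Real.sqrt (2 / 3)) s, ∀ p' ∈ barlowStacking 1 (Real.sqrt (2 / 3)) s, Ψ p = Ψ p' → p ≠ p' →
        ∃ σ : E3 → E3, IsContactAut s σ ∧ (∀ q ∈ barlowStacking 1 (Real.sqrt (2 / 3)) s, Ψ (σ q) = Ψ q) ∧ σ p = p' ∧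
          ∀ q ∈ barlowStacking 1 (Real.sqrt (2 / 3)) s, σ q ≠ q)
    (h₄ : ∀ (s : ℤ → ℤ) (σ : E3 → E3), IsHaggSeq s → IsContactAut s σ →
      (∀ q ∈ barlowStacking 1 (Real.sqrt (2 / 3)) s, σ q ≠ q) →
      (∀ q ∈ barlowStacking 1 (Real.sqrt (2 / 3)) s, dist q (σ q) ≠ 1) →
      (∀ q ∈ barlowStacking 1 (Real.sqrt (2 / 3)) s, ∀ m ∈ barlowStacking 1 (Real.sqrt (2 / 3)) s, dist q m = 1 → dist m (σ q) ≠ 1) →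
        ∃ τ : E3, τ ≠ 0 ∧ (∀ q ∈ barlowStacking 1 (Real.sqrt (2 / 3)) s, q + τ ∈ barlowStacking 1 (Real.sqrt (2 / 3)) s ∧ q - τ ∈ barlowStacking 1 (Real.sqrt (2 / 3)) s) ∧
          ∃ n : ℕ, ∀ q ∈ barlowStacking 1 (Real.sqrt (2 / 3)) s, σ^[n] q = q + τ)
    (h₅ : ∀ (S : Set E3) (s : ℤ → ℤ) (Ψ : E3 → E3) (τ : E3), IsHaggSeq s →
      (∀ p ∈ barlowStacking 1 (Real.sqrt (2 / 3)) s, bondNbrs S (Ψ p) ⊆ Ψ '' contacts s p) →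
      τ ≠ 0 → (∀ q ∈ barlowStacking 1 (Real.sqrt (2 / 3)) s, q + τ ∈ barlowStacking 1 (Real.sqrt (2 / 3)) s ∧ q - τ ∈ barlowStacking 1 (Real.sqrt (2 / 3)) s) → (∀ q ∈ barlowStacking 1 (Real.sqrt (2 / 3)) s, Ψ (q + τ) = Ψ q) →
        ∀ p ∈ barlowStacking 1 (Real.sqrt (2 / 3)) s, ∃ K : ℝ, ∀ n : ℕ,
          (Set.ncard (windowBall S (Ψ p) n) : ℝ) ≤ K * ((n : ℝ) + 1) ^ 2)
    (h₆ : ∀ S : Set E3, GoodShells S → ∀ x ∈ S, ∀ n : ℕ, 12 ≤ n →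
      ((n : ℝ) / 6) ^ 3 ≤ (Set.ncard (windowBall S x n) : ℝ)) :
    ∀ S : Set E3, S.Nonempty → GoodShells S → BarlowChart S := by
  intro S hne hG
  obtain ⟨s, hs, Ψ, hcov⟩ := h₂ S hne hG (h₁ S hG)
  obtain ⟨hmaps, hsurj, hstar, hlink⟩ := hcov
  -- Step 1: `Ψ` is injective on the model (the growth descent).
  have hinj : Set.InjOn Ψ (barlowStacking 1 (Real.sqrt (2 / 3)) s) := by
    intro p hp p' hp' hpp'
    by_contra hne'
    obtain ⟨σ, ⟨hbij, hcontact⟩, hdeck, -, hfree⟩ :=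
      h₃ S s Ψ hs ⟨hmaps, hsurj, hstar, hlink⟩ p hp p' hp' hpp' hne'
    -- the deck automorphism moves every site by graph distance ≥ 3
    have hd1 : ∀ q ∈ barlowStacking 1 (Real.sqrt (2 / 3)) s, dist q (σ q) ≠ 1 := by
      intro q hq h1
      have hσq : σ q ∈ contacts s q := ⟨hbij.mapsTo hq, h1⟩
      have hb : Ψ (σ q) ∈ bondNbrs S (Ψ q) := (hstar q hq).mapsTo hσq
      have hpos : 0 < dist (Ψ q) (Ψ (σ q)) := hb.2.1
      rw [hdeck q hq, dist_self] at hpos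
      exact lt_irrefl _ hpos
    have hd2 : ∀ q ∈ barlowStacking 1 (Real.sqrt (2 / 3)) s, ∀ m ∈ barlowStacking 1 (Real.sqrt (2 / 3)) s, dist q m = 1 → dist m (σ q) ≠ 1 := by
      intro q hq m hm hqm h2
      have hq' : q ∈ contacts s m := ⟨hq, by rw [dist_comm]; exact hqm⟩
      have hσq : σ q ∈ contacts s m := ⟨hbij.mapsTo hq, h2⟩
      exact hfree q hq ((hstar m hm).injOn hσq hq' (hdeck q hq))
    obtain ⟨τ, hτ, hper, n₀, hiter⟩ := h₄ s σ hs ⟨hbij, hcontact⟩ hfree hd1 hd2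
    -- `Ψ` is `τ`-invariant: iterate the deck relation
    have hiterB : ∀ k : ℕ, ∀ q ∈ barlowStacking 1 (Real.sqrt (2 / 3)) s, σ^[k] q ∈ barlowStacking 1 (Real.sqrt (2 / 3)) s ∧ Ψ (σ^[k] q) = Ψ q := by
      intro k
      induction k with
      | zero => intro q hq; exact ⟨hq, rfl⟩
      | succ k ih =>
        intro q hq
        obtain ⟨hkq, hΨk⟩ := ih q hq
        refine ⟨?_, ?_⟩
        · rw [Function.iterate_succ_apply']
          exact hbij.mapsTo hkq
        · rw [Function.iterate_succ_apply', hdeck _ hkq, hΨk]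
    have hΨτ : ∀ q ∈ barlowStacking 1 (Real.sqrt (2 / 3)) s, Ψ (q + τ) = Ψ q := by
      intro q hq
      rw [← hiter q hq]
      exact (hiterB n₀ q hq).2
    have hstarsurj : ∀ p ∈ barlowStacking 1 (Real.sqrt (2 / 3)) s, bondNbrs S (Ψ p) ⊆ Ψ '' contacts s p :=
      fun p hp => (hstar p hp).surjOn
    obtain ⟨K, hK⟩ := h₅ S s Ψ τ hs hstarsurj hτ hper hΨτ p hp
    -- choose a radius beating both bounds
    obtain ⟨n, hn⟩ := exists_nat_gt (max 12 (216 * K + 216))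
    have h12 : (12 : ℝ) < n := lt_of_le_of_lt (le_max_left _ _) hn
    have hn12 : 12 ≤ n := by exact_mod_cast h12.le
    have hKn : 216 * K + 216 < (n : ℝ) := lt_of_le_of_lt (le_max_right _ _) hn
    have hlow := h₆ S hG (Ψ p) (hmaps hp) n hn12
    have hup := hK n
    have hle : ((n : ℝ) / 6) ^ 3 ≤ K * ((n : ℝ) + 1) ^ 2 := hlow.trans hup
    set N : ℝ := (n : ℝ) with hN
    have hN0 : (0 : ℝ) ≤ N := by positivity
    rcases le_or_gt K 0 with hK0 | hK0
    · have h1 : K * (N + 1) ^ 2 ≤ 0 := mul_nonpos_of_nonpos_of_nonneg hK0 (sq_nonneg _)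
      have h2 : (0 : ℝ) < (N / 6) ^ 3 := by positivity
      linarith
    · have h1 : K * (N + 1) ^ 2 ≤ (N / 216 - 1) * (N + 1) ^ 2 :=
        mul_le_mul_of_nonneg_right (by linarith) (sq_nonneg _)
      have h2 : (N / 216 - 1) * (N + 1) ^ 2 < (N / 6) ^ 3 := by
        nlinarith [sq_nonneg N, hN0]
      linarith
  -- Step 2: bijection and bond-faithfulness.
  refine ⟨s, hs, Ψ, ⟨hmaps, hinj, hsurj⟩, fun p hp q hq => ⟨fun hpq => ?_, fun hb => ?_⟩⟩
  · have hq' : q ∈ contacts s p := ⟨hq, hpq⟩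
    exact ((hstar p hp).mapsTo hq').2
  · have hy : Ψ q ∈ bondNbrs S (Ψ p) := ⟨hmaps hq, hb⟩
    obtain ⟨q', hq', hqq'⟩ := (hstar p hp).surjOn hy
    have hqeq : q' = q := hinj hq'.1 hq hqq'
    rw [← hqeq]
    exact hq'.2

/-- **SKELETON THEOREM — the crux `ShellsToBarlowChart` BY NAME from the six registered stubs.**
No hypotheses; its `sorryAx` dependence is exactly the six `stub_*` (the composition
`barlowChart_of_stubs` is sorry-free), so closing the stubs closes the crux. -/
theorem ShellsToBarlowChart_of : ShellsToBarlowChart :=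
  shellsToBarlowChart_iff_scaled.2
    (barlowChart_of_stubs stub_localCharts
      (fun S hne hG hL => stub_developCovering S (stub_transportSystem S hne hG hL))
      stub_deckTransitive stub_powerTranslation stub_quotientGrowth stub_cubicGrowth)

end Summit.AtomisticToContinuum.Crystallization.Cruxes.ShellsToBarlowChart.DevelopTheModelGrowthDescent
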